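import Literature.NumberTheory.DiophantineGeometry.WeightedRootHeightLower
import HarnessLib

/-!
# Weil height of the ramification form `N` on `r^e = x(1-x)`

Companion of `SuperellipticHeights.lean` ([GenEll] = S. Mochizuki, *Arithmetic elliptic curves in
general position*, Math. J. Okayama Univ. 52 (2010), Prop. 1.4 (i); abc-iut cell, route item
`Summit.ABC.ABC.Theses.IUTThetaPilot.GenEllTwo`, S6's plan GENELLTWO-P1ROUTE §3(d), package W4a).
On `D_e : r^e = x(1-x)` (`e + 3 = 2m`, `s = 1 - 2x`) the form cutting out the ramification divisor of
`t = 1/r + r^{(e+1)/2}/s` is `N = -s³ + ((e+1)/2)·r^m − 2·r^{m+e}` (pole of order `3e + 3` at the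
point at infinity only). We work with `z := 2N = -2s³ + (e+1)·r^m − 4·r^{m+e}` (integer coefficients):
`(z + 2s³)^e = (x(1-x))^m · ((e+1) − 4x(1-x))^e`, a weighted integral relation over `ℤ[x]` with
weights `(wt x, wt z) = (e, 3e+3)` and full weighted degree of the constant term, whence

* `exists_abs_logHeight₁_ramForm_sub_le` — `|e·h_K(z) − (3e+3)·h_K(x)| ≤ C·[K:ℚ]`.

Everything is proved; no definitions, no named facts; classical height theory (Bombieri–Gubler §2.5)
— nothing here refers to the disputed parts of the abc-iut corpus.
-/

noncomputable section

open Height Finset Polynomial Real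

namespace Literature.NumberTheory.DiophantineGeometry

namespace Superelliptic

/-- The coefficient polynomials of the relation `(z + 2s³)^e − (X − X²)^m·((e+1) − 4(X − X²))^e = 0`
(`s = 1 − 2X`): `a_k = binom(e,k)·(2(1−2X)³)^{e−k}` for `0 < k`, and
`a_0 = (2(1−2X)³)^e − (X − X²)^m((e+1) − 4(X−X²))^e`; degree bounds `3(e−k)` resp. `= 3e+3`.
[cite: MochizukiGenEll2010, Thm 2.1 proof p.11] -/
private theorem ramForm_natDegree {e m : ℕ} (hem : e + 3 = 2 * m) (k : ℕ) :
    ((fun k : ℕ => if k = 0 then ((C 2 * (1 - C 2 * X) ^ 3) ^ e -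
        (X - X ^ 2) ^ m * (C ((e : ℤ) + 1) - C 4 * (X - X ^ 2)) ^ e : ℤ[X])
      else C (e.choose k : ℤ) * (C 2 * (1 - C 2 * X) ^ 3) ^ (e - k)) k).natDegree ≤
        (if k = 0 then 3 * e + 3 else 3 * (e - k)) ∧
    ((fun k : ℕ => if k = 0 then ((C 2 * (1 - C 2 * X) ^ 3) ^ e -
        (X - X ^ 2) ^ m * (C ((e : ℤ) + 1) - C 4 * (X - X ^ 2)) ^ e : ℤ[X])
      else C (e.choose k : ℤ) * (C 2 * (1 - C 2 * X) ^ 3) ^ (e - k)) 0).natDegree = 3 * e + 3 := by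
  have hs : (1 - C 2 * X : ℤ[X]).natDegree ≤ 1 := by
    refine (natDegree_sub_le _ _).trans (max_le (by simp) ?_)
    exact (natDegree_C_mul_le _ _).trans (by simp)
  have hb : (C 2 * (1 - C 2 * X) ^ 3 : ℤ[X]).natDegree ≤ 3 := by
    refine (natDegree_C_mul_le _ _).trans (natDegree_pow_le.trans ?_)
    simpa using Nat.mul_le_mul_left 3 hs
  have hbpow : ∀ n : ℕ, ((C 2 * (1 - C 2 * X) ^ 3 : ℤ[X]) ^ n).natDegree ≤ 3 * n := fun n =>
    natDegree_pow_le.trans (by simpa [mul_comm] using Nat.mul_le_mul_left n hb)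
  have hXX : (X - X ^ 2 : ℤ[X]).natDegree = 2 := by
    rw [natDegree_sub_eq_right_of_natDegree_lt] <;> simp
  have hXX0 : (X - X ^ 2 : ℤ[X]) ≠ 0 := by
    intro h; rw [h, natDegree_zero] at hXX; exact absurd hXX (by norm_num)
  have h4 : (C 4 * (X - X ^ 2) : ℤ[X]).natDegree = 2 := by rw [natDegree_C_mul (by norm_num), hXX]
  have hq : (C ((e : ℤ) + 1) - C 4 * (X - X ^ 2) : ℤ[X]).natDegree = 2 := by
    rw [natDegree_sub_eq_right_of_natDegree_lt, h4]
    rw [h4, natDegree_C]; norm_num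
  have hq0 : (C ((e : ℤ) + 1) - C 4 * (X - X ^ 2) : ℤ[X]) ≠ 0 := by
    intro h; rw [h, natDegree_zero] at hq; exact absurd hq (by norm_num)
  have hsecond : ((X - X ^ 2) ^ m * (C ((e : ℤ) + 1) - C 4 * (X - X ^ 2)) ^ e : ℤ[X]).natDegree
      = 3 * e + 3 := by
    rw [natDegree_mul (pow_ne_zero _ hXX0) (pow_ne_zero _ hq0), natDegree_pow, natDegree_pow, hXX, hq]
    omega
  have ha0 : (((C 2 * (1 - C 2 * X) ^ 3) ^ e -
      (X - X ^ 2) ^ m * (C ((e : ℤ) + 1) - C 4 * (X - X ^ 2)) ^ e : ℤ[X])).natDegree = 3 * e + 3 := by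
    rw [natDegree_sub_eq_right_of_natDegree_lt, hsecond]
    rw [hsecond]; exact (hbpow e).trans_lt (by omega)
  refine ⟨?_, by simpa using ha0⟩
  by_cases hk0 : k = 0
  · subst hk0; simp only [↓reduceIte]; exact ha0.le
  · simp only [hk0, ↓reduceIte]
    exact (natDegree_C_mul_le _ _).trans (hbpow _)

/-- The weighted relation for `z = -2s³ + (e+1)·r^m − 4·r^{m+e}` (`r^e = x(1-x)`, `s = 1 − 2x`):
`z^e + Σ_{k<e} a_k(x) z^k = 0`, i.e. `(z + 2s³)^e = (x(1-x))^m((e+1) − 4x(1-x))^e`.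
[cite: MochizukiGenEll2010, Thm 2.1 proof p.11] -/
private theorem ramForm_rel {K : Type*} [Field K] {e m : ℕ} (he : 0 < e) {x r z : K}
    (hr : r ^ e = x * (1 - x))
    (hz : z = -2 * (1 - 2 * x) ^ 3 + ((e : K) + 1) * r ^ m - 4 * r ^ (m + e)) :
    z ^ e + ∑ k ∈ range e, aeval x ((fun k : ℕ => if k = 0 then ((C 2 * (1 - C 2 * X) ^ 3) ^ e -
        (X - X ^ 2) ^ m * (C ((e : ℤ) + 1) - C 4 * (X - X ^ 2)) ^ e : ℤ[X])
      else C (e.choose k : ℤ) * (C 2 * (1 - C 2 * X) ^ 3) ^ (e - k)) k) * z ^ k = 0 := by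
  set b : K := 2 * (1 - 2 * x) ^ 3 with hb
  have hbin : (z + b) ^ e = ∑ k ∈ range (e + 1), z ^ k * b ^ (e - k) * (e.choose k : K) := add_pow _ _ _
  have hval : (z + b) ^ e = (x * (1 - x)) ^ m * (((e : K) + 1) - 4 * (x * (1 - x))) ^ e := by
    have h1 : z + b = r ^ m * (((e : K) + 1) - 4 * r ^ e) := by rw [hz, hb, pow_add]; ring
    rw [h1, mul_pow, ← pow_mul, mul_comm m e, pow_mul, hr]
  have hev : ∀ k ∈ range e, aeval x ((fun k : ℕ => if k = 0 then ((C 2 * (1 - C 2 * X) ^ 3) ^ e -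
        (X - X ^ 2) ^ m * (C ((e : ℤ) + 1) - C 4 * (X - X ^ 2)) ^ e : ℤ[X])
      else C (e.choose k : ℤ) * (C 2 * (1 - C 2 * X) ^ 3) ^ (e - k)) k) * z ^ k =
      z ^ k * b ^ (e - k) * (e.choose k : K) -
        (if k = 0 then (x * (1 - x)) ^ m * (((e : K) + 1) - 4 * (x * (1 - x))) ^ e else 0) := by
    intro k _
    have hC2 : aeval x (C 2 : ℤ[X]) = (2 : K) := by rw [aeval_C]; simp
    have hC4 : aeval x (C 4 : ℤ[X]) = (4 : K) := by rw [aeval_C]; simp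
    have hCe : aeval x (C ((e : ℤ) + 1) : ℤ[X]) = (e : K) + 1 := by rw [aeval_C]; simp
    have hCk : aeval x (C (e.choose k : ℤ) : ℤ[X]) = (e.choose k : K) := by rw [aeval_C]; simp
    by_cases hk0 : k = 0
    · subst hk0
      simp only [↓reduceIte, map_sub, map_pow, map_mul, map_one, aeval_X, hC2, hC4, hCe, hb, pow_zero,
        Nat.sub_zero, Nat.choose_zero_right, Nat.cast_one]
      ring
    · simp only [hk0, ↓reduceIte, map_sub, map_pow, map_mul, map_one, aeval_X, hC2, hCk, hb]
      ring
  rw [Finset.sum_congr rfl hev, Finset.sum_sub_distrib, Finset.sum_ite_eq' (range e) 0,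
    if_pos (mem_range.mpr he)]
  have hsplit : ∑ k ∈ range (e + 1), z ^ k * b ^ (e - k) * (e.choose k : K) =
      (∑ k ∈ range e, z ^ k * b ^ (e - k) * (e.choose k : K)) + z ^ e := by
    rw [Finset.sum_range_succ, Nat.sub_self, pow_zero, mul_one, Nat.choose_self, Nat.cast_one, mul_one]
  have key : z ^ e + (∑ k ∈ range e, z ^ k * b ^ (e - k) * (e.choose k : K)) =
      (x * (1 - x)) ^ m * (((e : K) + 1) - 4 * (x * (1 - x))) ^ e := by rw [← hval, hbin, hsplit, add_comm]
  calc z ^ e + ((∑ k ∈ range e, z ^ k * b ^ (e - k) * (e.choose k : K)) -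
        (x * (1 - x)) ^ m * (((e : K) + 1) - 4 * (x * (1 - x))) ^ e)
      = (z ^ e + ∑ k ∈ range e, z ^ k * b ^ (e - k) * (e.choose k : K)) -
        (x * (1 - x)) ^ m * (((e : K) + 1) - 4 * (x * (1 - x))) ^ e := by ring
    _ = 0 := by rw [key]; ring

/-- **`r^e = x(1-x)`, `e + 3 = 2m`, `z = -2(1-2x)³ + (e+1)·r^m − 4·r^{m+e}` (twice the ramification
form `N` of the plan) ⟹ `|e·h_K(z) − (3e+3)·h_K(x)| ≤ C·[K:ℚ]`** for every number field `K`, with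
`C` depending only on `e ≥ 1`: `z` has a pole of order `3e+3` at infinity only, so its Weil height
compares with `h(x)` with the sharp slope `(3e+3)/e` — [GenEll] Prop. 1.4 (i) for `z, x : D_e → ℙ¹`,
from the weighted relation `(z + 2s³)^e = (x−x²)^m((e+1) − 4(x−x²))^e`. [cite: MochizukiGenEll2010, Prop 1.4 (i) p.6] -/
theorem exists_abs_logHeight₁_ramForm_sub_le {e m : ℕ} (he : 0 < e) (hem : e + 3 = 2 * m) :
    ∃ C : ℝ, ∀ (K : Type) [Field K] [NumberField K] (x r : K), r ^ e = x * (1 - x) →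
      |(e : ℝ) * logHeight₁ (-2 * (1 - 2 * x) ^ 3 + ((e : K) + 1) * r ^ m - 4 * r ^ (m + e)) -
        (3 * e + 3) * logHeight₁ x| ≤ C * Module.finrank ℚ K := by
  set a : ℕ → ℤ[X] := fun k => if k = 0 then ((C 2 * (1 - C 2 * X) ^ 3) ^ e -
        (X - X ^ 2) ^ m * (C ((e : ℤ) + 1) - C 4 * (X - X ^ 2)) ^ e : ℤ[X])
      else C (e.choose k : ℤ) * (C 2 * (1 - C 2 * X) ^ 3) ^ (e - k) with ha
  have hd : ∀ k < e, e * (a k).natDegree ≤ (3 * e + 3) * (e - k) := by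
    intro k hk
    obtain ⟨h1, -⟩ := ramForm_natDegree (e := e) hem k
    rw [ha]
    by_cases hk0 : k = 0
    · subst hk0
      simp only [↓reduceIte] at h1 ⊢
      calc e * _ ≤ e * (3 * e + 3) := Nat.mul_le_mul_left e h1
        _ = (3 * e + 3) * (e - 0) := by rw [Nat.sub_zero, mul_comm]
    · simp only [hk0, ↓reduceIte] at h1 ⊢
      calc e * _ ≤ e * (3 * (e - k)) := Nat.mul_le_mul_left e h1
        _ ≤ (3 * e + 3) * (e - k) := by nlinarith
  have h0 : e * (a 0).natDegree = (3 * e + 3) * e := by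
    rw [ha, (ramForm_natDegree (e := e) hem 0).2, mul_comm]
  obtain ⟨C, hC⟩ := WeightedRoot.exists_abs_sub_le_of_weighted he he a hd h0
  refine ⟨C, fun K _ _ x r hr => ?_⟩
  have h := hC K (-2 * (1 - 2 * x) ^ 3 + ((e : K) + 1) * r ^ m - 4 * r ^ (m + e)) x
    (ramForm_rel he hr rfl)
  simpa only [Nat.cast_add, Nat.cast_mul, Nat.cast_ofNat] using h

end Superelliptic

end Literature.NumberTheory.DiophantineGeometry

end
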